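import Summits.ABC.IUTFork.Repair.RHHeightScalingR4RayFaces
import HarnessLib

/-!
# R-H ROUND 4, row R4OBJ-FACES — THE TYPED CLASS PROPS DECIDED ON THE KERNEL (part 2): the round-3 HEIGHT RAY itself (`Ray_NegExponent (heightRay …)`
# — the D2 verdict in abc-iut-rh2-T-1's words), CLASS (i) DEGREE (`DegScaled_HeightNegExponent`, `¬ DegScaled_HeightDoor`, `DegScaled_DegreeRayContentFree`)
# and CLASS (ii) MULTI-l (`MultiL_MeanPoolNegExponent`, `MultiL_CrossPoolDoorShape`) — PROVED (PROOF-ONLY, 0 definitions)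

abc-iut cell, rung LADDER-ABC:A2.RESCUE.H, ROUND 4 (HUMAN D-0133 · D-0134 · D-0135; KEY `wake/KEY-abc-iut-rh2-w-2-R4OBJ-FACES.md`, abc-iut-rh-lead g5
2026-08-27T13:46:57Z; referee rh-ref-2). Seat abc-iut-rh2-w-2. Sequel of this seat's `Repair/RHHeightScalingR4RayFaces.lean` (generic ray face `ray_negExponent` /
`ray_door_of_linear_floor`, classes (iii)/(iv)). THE PROPS are abc-iut-rh2-T-1's `Repair/RHHeightScalingR4Classes.lean` (p538051 + p538930): `heightRay`, `degRay`,
`degScaledHeightRay`, `DegScaled_HeightNegExponent`, `DegScaled_HeightDoor`, `DegScaled_DegreeRayContentFree`, `multiLMean`, `multiLPool`, `multiLCross`,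
`MultiL_MeanPoolNegExponent`, `MultiL_CrossPoolDoorShape` — cited BY NAME. Class inputs of record: rh2-q2-hull `ROUND4/R4-6-DEG-rh2-q2-hull.md` (+ p537602),
rh2-q2-eq `ROUND4/R4-6-MULTIL-rh2-q2-eq.md` (+ ★ p537489); abstract faces of this seat: p538733 `…R4DegreeFace`, `…R4MultiLFace`.
WHAT IS PROVED (namespace `Summit.ABC.IUTFork.Repair.RH.HeightScalingR4.RayFaces`, continued; [folklore] arithmetic; 0 `sorry`):
* §4 THE HEIGHT RAY: `totalDemand_heightRay` (`M(n) = n·M(1)`), `totalPrice_heightRay_le` (height-free cap), **`heightRay_negExponent`** («fixed places, only the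
  depth dilates ⇒ `Ray_NegExponent`»: the round-3 AXIS-D2 verdict of record — exponent `−1` for the netting envelope — as ONE theorem over T-1's `heightRay`).
* §5 CLASS (i): **`degScaled_heightNegExponent : DegScaled_HeightNegExponent`** (the ε-scaled datum's height ray IS a `heightRay`: §4 at the scaled integers),
  **`not_degScaled_heightDoor : ¬ DegScaled_HeightDoor`**, `totalDemand_degRay` (along the DEGREE ray at fixed height the mass does NOT move: `(u₁/ε)·(ε·m₁)`),
  **`degScaled_degreeRayContentFree : DegScaled_DegreeRayContentFree`** (requirement-side degree costs `tol(ε) ≥ a·ε` overtake the fixed mass: the degree ray is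
  CONTENT-FREE from `ε ≥ max(1, ⌈M̄/a⌉)` — VOID as a door) ⇒ census O-06: KILLED-BY-CONSISTENCY on the typed Props.
* §6 CLASS (ii): `sum_nu_mass_pos`, **`multiL_meanPoolNegExponent : MultiL_MeanPoolNegExponent`** ((R1) mean and (R2) pool: `ExponentAtMost (−1)` with constants
  `2·Σν·max(P,0)/M₁` resp. `2·(Σν·max(P,0))/(Σν·M₁)`), **`multiL_crossPoolDoorShape : MultiL_CrossPoolDoorShape`** ((R3×): a pooled COUNT growing linearly with
  the step against ONE requirement is door-SHAPED, constant `π₀/M₀` — the object needs the untyped cross-`l` transfer law R-07×, the class seat's residual)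
  ⇒ census O-07: (R1)/(R2) KILLED-BY-CONSISTENCY on the typed Prop; (R3×) door-SHAPED AS TYPED.
HONEST FRAMING: arithmetic about OUR typed rays and poolings; classes / rays / doors are claim-tagged hypotheses of the R4 census (modelling choices recorded in
`RHHeightScalingR4Classes` and the class seats' memos), never Literature facts; a multi-`l` Θ-link is not an object of [IUTchI–IV] (located by the class seat, not
adjudicated); nothing here asserts that abc is proved or refuted, or takes a side on [IUTchIII] Cor. 3.12 / [IUTchIV] Thm. 1.10 / the explicit-estimates paper
or on any author; typed ≠ proved (objects); door-SHAPED ≠ an object.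
-/

noncomputable section

namespace Summit.ABC.IUTFork.Repair.RH.HeightScalingR4.RayFaces

open Finset
open Summit.ABC.IUTFork.Repair.RH.HeightScaling Summit.ABC.IUTFork.Repair.RH.HeightScalingR4Classes

variable {ι : Type}

/-- `s ≥ 1 ⇒ s ≤ 2·⌊s⌋₊` (private twin of part 1's helper; `1 ≤ ⌊s⌋₊` is Mathlib's `Nat.one_le_floor_iff`). [folklore] -/
private theorem le_two_mul_natFloor' {s : ℝ} (hs : 1 ≤ s) : s ≤ 2 * (⌊s⌋₊ : ℝ) := by
  have h1 : (1 : ℝ) ≤ (⌊s⌋₊ : ℝ) := by exact_mod_cast (Nat.one_le_floor_iff s).mpr hs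
  have h2 : s < (⌊s⌋₊ : ℝ) + 1 := Nat.lt_floor_add_one s
  linarith

/-! ## §4. The round-3 HEIGHT RAY: `Ray_NegExponent (heightRay …)` -/

/-- **Along the height ray the mass is EXACTLY linear**: `M(n) = n·M(1)`. [folklore] -/
theorem totalDemand_heightRay (W : Finset ι) (L : ℕ) (e m₁ δ rin rout : ι → ℤ) (u : ι → ℝ) (tol : ℝ) (n : ℕ) :
    totalDemand (heightRay W L e m₁ δ rin rout u tol) n = (n : ℝ) * totalDemand (heightRay W L e m₁ δ rin rout u tol) 1 := by
  unfold totalDemand heightRay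
  dsimp only
  simp only [Nat.cast_one, one_mul]
  rw [mul_sum]
  refine sum_congr rfl fun w _ => ?_
  rw [sum_demand_dilate_real]
  push_cast
  ring

/-- **Along the height ray the price ceiling is height-free** (conjugate-fibre places: `0 < e`, `r_out ≤ r_in`, `u ≥ 0`):
`Π(n) ≤ Σ_W u_w·(δ_w + 2(r_in−r_out)_w + (e_w−1))·L(L+1)/2`. [folklore] -/
theorem totalPrice_heightRay_le (W : Finset ι) (L : ℕ) (e m₁ δ rin rout : ι → ℤ) (u : ι → ℝ) (tol : ℝ)
    (he : ∀ w ∈ W, 0 < e w) (hio : ∀ w ∈ W, rout w ≤ rin w) (hu : ∀ w ∈ W, 0 ≤ u w) (n : ℕ) :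
    totalPrice (heightRay W L e m₁ δ rin rout u tol) n ≤
      ∑ w ∈ W, u w * ((((δ w + 2 * (rin w - rout w) + (e w - 1)) * ((L : ℤ) * (L + 1)) : ℤ) : ℝ) / 2) := by
  unfold totalPrice heightRay
  dsimp only
  exact sum_le_sum fun w hw => mul_le_mul_of_nonneg_left (sum_price_le_cap_real (he w hw) (hio w hw) L) (hu w hw)

/-- **THE ROUND-3 VERDICT AS ONE THEOREM over abc-iut-rh2-T-1's `heightRay`**: fixed conjugate-fibre places (`0 < e`, `r_out ≤ r_in`), weights `u ≥ 0`, only the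
depth dilating, positive mass at step `1` ⇒ the netting envelope has a negative exponent (`Ray_NegExponent`; the AXIS-D2 table's «exponent −1» for print's
EX × across tier, hence for every round-3 class). [folklore] -/
theorem heightRay_negExponent (W : Finset ι) (L : ℕ) (e m₁ δ rin rout : ι → ℤ) (u : ι → ℝ) (tol : ℝ)
    (he : ∀ w ∈ W, 0 < e w) (hio : ∀ w ∈ W, rout w ≤ rin w) (hu : ∀ w ∈ W, 0 ≤ u w)
    (hM1 : 0 < totalDemand (heightRay W L e m₁ δ rin rout u tol) 1) :
    Ray_NegExponent (heightRay W L e m₁ δ rin rout u tol) :=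
  ray_negExponent _ hM1 (fun n _ => by rw [totalDemand_heightRay W L e m₁ δ rin rout u tol n])
    fun n _ => totalPrice_heightRay_le W L e m₁ δ rin rout u tol he hio hu n

/-! ## §5. CLASS (i) DEGREE -/

/-- **`DegScaled_HeightNegExponent` HOLDS** (census O-06: at every degree step `ε ≥ 1` the height ray of the `ε`-scaled datum is a `heightRay` over the scaled
conjugate-fibre integers `e′ = ε·e₁ > 0`, `r_out′ = routLaw ε ≤ r_in′`, weights `u₁/ε ≥ 0`, so §4 applies: `Ray_NegExponent`). [folklore] -/
theorem degScaled_heightNegExponent : DegScaled_HeightNegExponent := by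
  intro ι W L p e₁ m₁ δ₁ routLaw u₁ tolLaw ε hε he₁ _hm₁ _hδ hrout hu₁ hM1
  have hε0 : (0 : ℤ) < (ε : ℤ) := by exact_mod_cast lt_of_lt_of_le Nat.zero_lt_one hε
  unfold degScaledHeightRay at hM1 ⊢
  refine heightRay_negExponent _ _ _ _ _ _ _ _ _ (fun w hw => mul_pos hε0 (he₁ w hw)) (fun w hw => hrout w hw)
    (fun w hw => div_nonneg (hu₁ w hw) (by positivity)) hM1

/-- **`DegScaled_HeightDoor` FAILS** (negation of the ∃-form: (i-a) + p532994 `not_doorAt_of_negExponent`). KILLED-BY-CONSISTENCY, kernel face. [folklore] -/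
theorem not_degScaled_heightDoor : ¬ DegScaled_HeightDoor := by
  rintro ⟨ι, W, L, p, e₁, m₁, δ₁, routLaw, u₁, tolLaw, ε, hε, he₁, hm₁, hδ, hrout, hu₁, hM1, hdoor⟩
  exact not_doorAt_of_negExponent (degScaled_heightNegExponent ι W L p e₁ m₁ δ₁ routLaw u₁ tolLaw ε hε he₁ hm₁ hδ hrout hu₁ hM1) hdoor

/-- **Along the DEGREE ray at fixed height the mass does NOT move**: for `n ≥ 1`, `M(n) = Σ_W u₁(w)·Σ_j demand (m₁ w) j` (`(u₁/n)·(n·m₁)`: the explicit-estimates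
paper's normalisation, rh2-q2-hull R1). [folklore] -/
theorem totalDemand_degRay (W : Finset ι) (L : ℕ) (p : ι → ℕ) (e₁ m₁ δ₁ : ι → ℤ) (routLaw : ℕ → ι → ℤ) (u₁ : ι → ℝ) (tolLaw : ℕ → ℝ)
    {n : ℕ} (hn : 1 ≤ n) :
    totalDemand (degRay W L p e₁ m₁ δ₁ routLaw u₁ tolLaw) n = ∑ w ∈ W, u₁ w * ((∑ k ∈ range L, demand (m₁ w) (1 + (k : ℤ)) : ℤ) : ℝ) := by
  unfold totalDemand degRay
  dsimp only
  have hn' : (n : ℝ) ≠ 0 := by exact_mod_cast (lt_of_lt_of_le Nat.zero_lt_one hn).ne'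
  refine sum_congr rfl fun w _ => ?_
  rw [sum_demand_dilate_real]
  push_cast
  field_simp

/-- **`DegScaled_DegreeRayContentFree` HOLDS** (census O-06 (i-c): with requirement-side degree costs `tol(ε) ≥ a·ε`, `a > 0`, and a FIXED mass along the degree
ray, the requirement `M̄ − tol(ε)` is `≤ 0` from `ε ≥ max(1, ⌈M̄/a⌉)` on — the degree ray is CONTENT-FREE there, its automatic `Ray_Door` VOID). [folklore] -/
theorem degScaled_degreeRayContentFree : DegScaled_DegreeRayContentFree := by
  intro ι W L p e₁ m₁ δ₁ routLaw u₁ tolLaw ⟨a, ha, htol⟩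
  set Mbar : ℝ := ∑ w ∈ W, u₁ w * ((∑ k ∈ range L, demand (m₁ w) (1 + (k : ℤ)) : ℤ) : ℝ) with hMbar
  refine ⟨max 1 ⌈Mbar / a⌉₊, fun n hn => ?_⟩
  have hn1 : 1 ≤ n := le_trans (le_max_left _ _) hn
  have hnc : ⌈Mbar / a⌉₊ ≤ n := le_trans (le_max_right _ _) hn
  have hceil : Mbar / a ≤ (n : ℝ) := (Nat.le_ceil _).trans (by exact_mod_cast hnc)
  have hMn : Mbar ≤ a * n := by
    rw [div_le_iff₀ ha] at hceil
    linarith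
  unfold requirement
  rw [totalDemand_degRay W L p e₁ m₁ δ₁ routLaw u₁ tolLaw hn1, ← hMbar]
  have ht := htol n hn1
  have : (degRay W L p e₁ m₁ δ₁ routLaw u₁ tolLaw).tol n = tolLaw n := rfl
  rw [this]
  linarith

/-! ## §6. CLASS (ii) MULTI-l -/

/-- With `ν ≥ 0`, `Σ ν = 1` and `M₁ > 0` on `Λ`, the pooled slope `Σ_Λ ν_l·M₁(l)` is positive. [folklore] -/
theorem sum_nu_mass_pos {κ : Type} (Λ : Finset κ) (ν M₁ : κ → ℝ) (hν : ∀ l ∈ Λ, 0 ≤ ν l) (hsum : ∑ l ∈ Λ, ν l = 1)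
    (hM₁ : ∀ l ∈ Λ, 0 < M₁ l) : 0 < ∑ l ∈ Λ, ν l * M₁ l := by
  by_contra h
  have hnn : ∀ l ∈ Λ, 0 ≤ ν l * M₁ l := fun l hl => mul_nonneg (hν l hl) (hM₁ l hl).le
  have h0 : ∑ l ∈ Λ, ν l * M₁ l = 0 := le_antisymm (not_lt.mp h) (sum_nonneg hnn)
  have hz := (sum_eq_zero_iff_of_nonneg hnn).mp h0
  have hν0 : ∀ l ∈ Λ, ν l = 0 := fun l hl => by
    have := hz l hl
    rcases mul_eq_zero.mp this with h1 | h1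
    · exact h1
    · exact absurd h1 (hM₁ l hl).ne'
  have : ∑ l ∈ Λ, ν l = 0 := sum_eq_zero hν0
  linarith

/-- **`MultiL_MeanPoolNegExponent` HOLDS** (census O-07 (R1)/(R2): the ν-mean of per-`l` netting-envelope fractions and the pooled fraction both have exponent
`−1` when every packet has linear mass and a height-free price ceiling — combining `l` re-averages the constant and changes no exponent). [folklore] -/
theorem multiL_meanPoolNegExponent : MultiL_MeanPoolNegExponent := by
  intro ι κ Λ ν R M₁ P hν hsum hM₁ hM hP
  have hD : 0 < ∑ l ∈ Λ, ν l * M₁ l := sum_nu_mass_pos Λ ν M₁ hν hsum hM₁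
  -- the per-packet bound at an integer step `n ≥ 1`
  have hpk : ∀ l ∈ Λ, ∀ n : ℕ, 1 ≤ n → nettingKept (R l) n ≤ max (P l) 0 / ((n : ℝ) * M₁ l) := fun l hl n hn =>
    nettingKept_le_div (R l) n (hM₁ l hl) hn (by rw [hM l hl n hn]) (hP l hl n hn)
  constructor
  · -- (R1) the mean
    refine ⟨-1, 2 * ∑ l ∈ Λ, ν l * (max (P l) 0 / M₁ l), by norm_num,
      mul_nonneg zero_le_two (sum_nonneg fun l hl => mul_nonneg (hν l hl) (div_nonneg (le_max_right _ _) (hM₁ l hl).le)),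
      fun s hs => ?_⟩
    have hn := (Nat.one_le_floor_iff s).mpr hs
    have h2 := le_two_mul_natFloor' hs
    have hs0 : 0 < s := lt_of_lt_of_le zero_lt_one hs
    have hnpos : (0 : ℝ) < (⌊s⌋₊ : ℝ) := by exact_mod_cast lt_of_lt_of_le Nat.zero_lt_one hn
    unfold stepProfile multiLMean
    rw [Real.rpow_neg_one]
    calc ∑ l ∈ Λ, ν l * nettingKept (R l) ⌊s⌋₊
        ≤ ∑ l ∈ Λ, ν l * (max (P l) 0 / ((⌊s⌋₊ : ℝ) * M₁ l)) :=
          sum_le_sum fun l hl => mul_le_mul_of_nonneg_left (hpk l hl _ hn) (hν l hl)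
      _ = (⌊s⌋₊ : ℝ)⁻¹ * ∑ l ∈ Λ, ν l * (max (P l) 0 / M₁ l) := by
          rw [mul_sum]
          refine sum_congr rfl fun l hl => ?_
          have hM0 : M₁ l ≠ 0 := (hM₁ l hl).ne'
          field_simp
      _ ≤ (2 * s⁻¹) * ∑ l ∈ Λ, ν l * (max (P l) 0 / M₁ l) := by
          refine mul_le_mul_of_nonneg_right ?_
            (sum_nonneg fun l hl => mul_nonneg (hν l hl) (div_nonneg (le_max_right _ _) (hM₁ l hl).le))
          rw [inv_le_comm₀ hnpos (by positivity)]
          have : (2 * s⁻¹)⁻¹ = s / 2 := by field_simp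
          rw [this]
          linarith
      _ = (2 * ∑ l ∈ Λ, ν l * (max (P l) 0 / M₁ l)) * s⁻¹ := by ring
  · -- (R2) the pool
    refine ⟨-1, 2 * (∑ l ∈ Λ, ν l * max (P l) 0) / ∑ l ∈ Λ, ν l * M₁ l, by norm_num,
      div_nonneg (mul_nonneg zero_le_two (sum_nonneg fun l hl => mul_nonneg (hν l hl) (le_max_right _ _))) hD.le,
      fun s hs => ?_⟩
    have hn := (Nat.one_le_floor_iff s).mpr hs
    have h2 := le_two_mul_natFloor' hs
    have hs0 : 0 < s := lt_of_lt_of_le zero_lt_one hs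
    have hnpos : (0 : ℝ) < (⌊s⌋₊ : ℝ) := by exact_mod_cast lt_of_lt_of_le Nat.zero_lt_one hn
    unfold stepProfile multiLPool
    rw [Real.rpow_neg_one]
    have hden : ∑ l ∈ Λ, ν l * totalDemand (R l) ⌊s⌋₊ = (⌊s⌋₊ : ℝ) * ∑ l ∈ Λ, ν l * M₁ l := by
      rw [mul_sum]
      exact sum_congr rfl fun l hl => by rw [hM l hl _ hn]; ring
    have hnum : ∑ l ∈ Λ, ν l * min (totalDemand (R l) ⌊s⌋₊) (totalPrice (R l) ⌊s⌋₊) ≤ ∑ l ∈ Λ, ν l * max (P l) 0 :=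
      sum_le_sum fun l hl => mul_le_mul_of_nonneg_left
        ((min_le_right _ _).trans ((hP l hl _ hn).trans (le_max_left _ _))) (hν l hl)
    have hdenpos : 0 < (⌊s⌋₊ : ℝ) * ∑ l ∈ Λ, ν l * M₁ l := mul_pos hnpos hD
    rw [hden]
    calc (∑ l ∈ Λ, ν l * min (totalDemand (R l) ⌊s⌋₊) (totalPrice (R l) ⌊s⌋₊)) / ((⌊s⌋₊ : ℝ) * ∑ l ∈ Λ, ν l * M₁ l)
        ≤ (∑ l ∈ Λ, ν l * max (P l) 0) / ((⌊s⌋₊ : ℝ) * ∑ l ∈ Λ, ν l * M₁ l) :=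
          div_le_div_of_nonneg_right hnum hdenpos.le
      _ ≤ (∑ l ∈ Λ, ν l * max (P l) 0) / (s / 2 * ∑ l ∈ Λ, ν l * M₁ l) :=
          div_le_div_of_nonneg_left (sum_nonneg fun l hl => mul_nonneg (hν l hl) (le_max_right _ _)) (by positivity)
            (by nlinarith)
      _ = 2 * (∑ l ∈ Λ, ν l * max (P l) 0) / (∑ l ∈ Λ, ν l * M₁ l) * s⁻¹ := by
          field_simp

/-- **`MultiL_CrossPoolDoorShape` HOLDS AS TYPED** (census O-07 (R3×): pooling a prime COUNT `≥ n` at step `n`, each pooled packet keeping `≥ π₀ > 0`, against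
ONE requirement `n·M₀`, is a `DoorAt` with constant `π₀/M₀` — door-SHAPED; the OBJECT needs the untyped cross-`l` transfer law R-07×, not in [IUTchI–IV]).
[folklore] -/
theorem multiL_crossPoolDoorShape : MultiL_CrossPoolDoorShape := by
  intro ι κ Λ R R₀ π₀ M₀ hπ hM₀ hcard hkeep hM
  refine ⟨π₀ / M₀, div_pos hπ hM₀, fun s hs => ?_⟩
  have hn := (Nat.one_le_floor_iff s).mpr hs
  have hnpos : (0 : ℝ) < (⌊s⌋₊ : ℝ) := by exact_mod_cast lt_of_lt_of_le Nat.zero_lt_one hn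
  unfold stepProfile multiLCross
  rw [hM _ hn]
  have hden : 0 < (⌊s⌋₊ : ℝ) * M₀ := mul_pos hnpos hM₀
  rw [le_div_iff₀ hden]
  -- numerator ≥ card • π₀ ≥ n·π₀
  have hsum : ((Λ ⌊s⌋₊).card : ℝ) * π₀ ≤ ∑ l ∈ Λ ⌊s⌋₊, min (totalDemand (R l) ⌊s⌋₊) (totalPrice (R l) ⌊s⌋₊) := by
    have h := card_nsmul_le_sum (Λ ⌊s⌋₊) (fun l => min (totalDemand (R l) ⌊s⌋₊) (totalPrice (R l) ⌊s⌋₊)) π₀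
      (fun l hl => hkeep _ hn l hl)
    simpa [nsmul_eq_mul] using h
  have hc : (⌊s⌋₊ : ℝ) ≤ ((Λ ⌊s⌋₊).card : ℝ) := by exact_mod_cast hcard _ hn
  calc π₀ / M₀ * ((⌊s⌋₊ : ℝ) * M₀) = (⌊s⌋₊ : ℝ) * π₀ := by field_simp
    _ ≤ ((Λ ⌊s⌋₊).card : ℝ) * π₀ := mul_le_mul_of_nonneg_right hc hπ.le
    _ ≤ _ := hsum

end Summit.ABC.IUTFork.Repair.RH.HeightScalingR4.RayFaces

end
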